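import Summits.BirchSwinnertonDyer.BirchSwinnertonDyer.Theorems.ResidualThetaTransportAtTwoResidualSignedLambdaLowerCMAtTwoRelaxedDeepHalf
import Summits.BirchSwinnertonDyer.BirchSwinnertonDyer.Theorems.ResidualThetaTransportAtTwoResidualSignedLambdaLowerCMAtTwoImprimitiveDuality
import HarnessLib

/-!
# The PLACE-CUT glue of RSL_g's deep half: (S4₂ at `2`) ∧ (S4₀ away from `2`) ∧ (EH reciprocity) ⟹ the relaxed deep half `hDHrel`
# of `CharIdealLambda.deepHalfSigma_of_relaxed`, on its own carriers — and the `2 •` (EH₂) re-run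

Route `ResidualThetaTransportAtTwo` (RTT), crux RSL_g `ResidualSignedLambdaLowerCMAtTwo` (stmt-BirchSwinnertonDyer-22608); width seat
`prover-bsd-wall-tp2-p2x-w2` g17 (`--supports`, closes nothing). THEOREMS ONLY (no definition, no named fact, no instance, no `sorry`). BSD is
not proved by any of this; RSL_g is not proved here. STUB-PLAN rev 12–14 Q49 / U37–U38 / U44 / S57 (1): the stub-critic's kernel-checked
certificates `Cruxes/ResidualThetaCountLowerPureAtTwo/Sketch_scrit_g12_placecut.lean` (stub-critic g12, V41) and the λ-currency glue §B of
`Sketch_sidea_k1_g9.lean` (stub-ideation seat k1 gen 9, V40), landed as theorems — the file that makes the v2b split of the lead's skeleton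
`onepair` a 30-line edit.

Carriers (those of p673742 `CharIdealLambda.deepHalfSigma_of_relaxed`): local duality maps `c₂ : P₀ →ₗ[A] D₂⋆`, `cS : PS →ₗ[A] DS⋆` with values
in `AddCircle` through `CharacterModule` (CONTRAVARIANT scalar action `(a • φ) d = φ (a • d)` — so the scalar bookkeeping evaluates the
orthogonality hypothesis at `a₀ • s` instead of scaling values), localisations `loc₂`, `locS` of the test classes `SelRel`, and the global
localisation-with-duality maps `ld₂ : H →ₗ[A] P₀`, `ldS : H →ₗ[A] PS`.

* §1 **`hDHrel_of_placeCut`** (U37): S4₂ (`h2`: a functional at `2` killing `loc₂(SelRel)` is, up to `a ≠ 0`, `ld₂` of a family with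
  `ldS = 0`) ∧ S4₀ (`h0`: a functional at `S₀` killing `locS` of the classes with `loc₂ s = 0` is, up to `a ≠ 0`, an `ldS`) ∧ EH (`hEH`:
  SelRel-wide reciprocity `c₂ (ld₂ x) (loc₂ s) + cS (ldS x) (locS s) = 0`) ⟹ `hDHrel` VERBATIM with `loc' := ld₂.prod ldS`;
  **`hDHrel_of_placeCut_of_two_nsmul`** (U44): the same from the honest `2 •`-form EH₂ of reciprocity (real places), `(2 : A) ≠ 0`;
  `atTwo_of_hDHrel` (U37′): the converse slice at `2`; `pair_locd_eq_zero_of_reciprocity` (U38) and its `2 •` twin: SelRel-wide EH ⟹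
  `pair (locd x) = 0` for every `x` (so p673478's `(EH_Z)` for any `Z ≤ H`) under `hcompat` / `hloc`.
* §2 **`deepHalfSigma_of_placeCut`** — p673742 `deepHalfSigma_of_relaxed` FED by the three blocks: the N5 binder `hDH` for `(P, pair, locd)`.
* §3 λ-currency (corank road): `finrank_baseChange_quotient_map_eq_add` (`λ(Λ/𝒸 H_str) = λ(𝐇¹/H_str) + λ(Λ/𝒸 𝐇¹)` for injective `𝒸`) and
  `add_finrank_le_of_placeCut` (`Σ + λ(Λ/𝒸 𝐇¹) ≤ λ(Sg⋆)` along a flag `Fine ≤ Str₂ ≤ Sg` from the two block inequalities; the defect cancels).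

References: [Kobayashi2003] Thm. 7.3 ((7.17)–(7.21)); [MilneADT2006] Ch. I Thm. 4.10 (b); [Rubin2000] App. B §B.3; [BurungaleTian2026] Thm. 2.6.
-/

set_option autoImplicit false
-- the Theorems namespace of this sub repeats the summit name by design (D-0017 nested layout)
set_option linter.dupNamespace false

noncomputable section

open scoped TensorProduct

namespace Summit.BirchSwinnertonDyer.BirchSwinnertonDyer.Theorems.PlaceCutGlue

universe u v w

/-! ## §1 Element-level glue on the carriers of `deepHalfSigma_of_relaxed` -/

section ElementGlue

variable {A : Type u} [CommRing A]
  {P₀ : Type v} [AddCommGroup P₀] [Module A P₀]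
  {PS : Type v} [AddCommGroup PS] [Module A PS]
  {D₂ : Type v} [AddCommGroup D₂] [Module A D₂]
  {DS : Type v} [AddCommGroup DS] [Module A DS]
  {P : Type v} [AddCommGroup P] [Module A P]
  {H : Type v} [AddCommGroup H] [Module A H]
  {SelRel : Type v} [AddCommGroup SelRel] [Module A SelRel]

/-- **The place cut (U37): S4₂ ∧ S4₀ ∧ EH ⟹ `hDHrel`** of `CharIdealLambda.deepHalfSigma_of_relaxed`, on its own carriers, with
`loc' := ld₂.prod ldS`. Restrict `(z, χ)` to the classes with `loc₂ s = 0` (there `c₂ z (loc₂ s) = 0` is `map_zero`, so S4₀ gives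
`a₀ • χ = ldS x₀`), correct `z` by `x₀` using reciprocity at `a₀ • s`, apply S4₂ to `a₀ • z − ld₂ x₀`, recombine; `[NoZeroDivisors A]` for
`a₁ a₀ ≠ 0`. [cite: Kobayashi2003, Thm. 7.3 ((7.17)–(7.21), pp. 12–13)] [cite: MilneADT2006, Ch. I, Thm. 4.10 (b)] -/
theorem hDHrel_of_placeCut [NoZeroDivisors A]
    (c₂ : P₀ →ₗ[A] CharacterModule D₂) (cS : PS →ₗ[A] CharacterModule DS)
    (loc₂ : SelRel →ₗ[A] D₂) (locS : SelRel →ₗ[A] DS)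
    (ld₂ : H →ₗ[A] P₀) (ldS : H →ₗ[A] PS)
    (hEH : ∀ (x : H) (s : SelRel), c₂ (ld₂ x) (loc₂ s) + cS (ldS x) (locS s) = 0)
    (h2 : ∀ z : P₀, (∀ s : SelRel, c₂ z (loc₂ s) = 0) →
      ∃ a : A, a ≠ 0 ∧ ∃ x : H, ldS x = 0 ∧ a • z = ld₂ x)
    (h0 : ∀ χ : PS, (∀ s : SelRel, loc₂ s = 0 → cS χ (locS s) = 0) →
      ∃ a : A, a ≠ 0 ∧ ∃ x : H, a • χ = ldS x) :
    ∀ t : P₀ × PS, (∀ s : SelRel, c₂ t.1 (loc₂ s) + cS t.2 (locS s) = 0) →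
      ∃ a : A, a ≠ 0 ∧ ∃ x : H, a • t = (ld₂.prod ldS) x := by
  rintro ⟨z, χ⟩ ht
  have hχ : ∀ s : SelRel, loc₂ s = 0 → cS χ (locS s) = 0 := by
    intro s hs
    have h := ht s
    rw [hs, map_zero, zero_add] at h
    exact h
  obtain ⟨a₀, ha₀, x₀, hx₀⟩ := h0 χ hχ
  have hz' : ∀ s : SelRel, c₂ (a₀ • z - ld₂ x₀) (loc₂ s) = 0 := by
    intro s
    have h1 : c₂ z (loc₂ (a₀ • s)) + cS χ (locS (a₀ • s)) = 0 := ht (a₀ • s)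
    rw [map_smul loc₂ a₀ s, map_smul locS a₀ s] at h1
    have h2 : c₂ (ld₂ x₀) (loc₂ s) + cS (ldS x₀) (locS s) = 0 := hEH x₀ s
    rw [← hx₀, map_smul cS a₀ χ, CharacterModule.smul_apply] at h2
    have e0 : c₂ (a₀ • z - ld₂ x₀) (loc₂ s) = (c₂ z) (a₀ • loc₂ s) - (c₂ (ld₂ x₀)) (loc₂ s) := by
      rw [map_sub c₂, map_smul c₂ a₀ z]
      rfl
    have e1 : c₂ z (a₀ • loc₂ s) = -cS χ (a₀ • locS s) := eq_neg_of_add_eq_zero_left h1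
    have e2 : c₂ (ld₂ x₀) (loc₂ s) = -cS χ (a₀ • locS s) := eq_neg_of_add_eq_zero_left h2
    rw [e0, e1, e2, sub_self]
  obtain ⟨a₁, ha₁, x₁, hx₁S, hx₁⟩ := h2 _ hz'
  refine ⟨a₁ * a₀, mul_ne_zero ha₁ ha₀, a₁ • x₀ + x₁, ?_⟩
  refine Prod.ext ?_ ?_
  · show (a₁ * a₀) • z = ld₂ (a₁ • x₀ + x₁)
    rw [mul_smul, map_add, map_smul, ← hx₁, smul_sub, add_sub_cancel]
  · show (a₁ * a₀) • χ = ldS (a₁ • x₀ + x₁)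
    rw [mul_smul, hx₀, map_add, map_smul, hx₁S, add_zero]

/-- **The place cut re-run with the `2 •`-form of reciprocity (U44): S4₂ ∧ S4₀ ∧ EH₂ ⟹ `hDHrel`**, where EH₂ is
`2 • (c₂ (ld₂ x) (loc₂ s) + cS (ldS x) (locS s)) = 0` (the honest factor `2` of the real places) and `(2 : A) ≠ 0`: correct
`2a₀ • z` by `ld₂ (2 • x₀)`; the slack becomes `a₁ · (2 a₀)`. [cite: Kobayashi2003, Thm. 7.3 ((7.17)–(7.21), pp. 12–13)]
[cite: MilneADT2006, Ch. I, Thm. 4.10 (b)] -/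
theorem hDHrel_of_placeCut_of_two_nsmul [NoZeroDivisors A] (htwo : (2 : A) ≠ 0)
    (c₂ : P₀ →ₗ[A] CharacterModule D₂) (cS : PS →ₗ[A] CharacterModule DS)
    (loc₂ : SelRel →ₗ[A] D₂) (locS : SelRel →ₗ[A] DS)
    (ld₂ : H →ₗ[A] P₀) (ldS : H →ₗ[A] PS)
    (hEH₂ : ∀ (x : H) (s : SelRel), 2 • (c₂ (ld₂ x) (loc₂ s) + cS (ldS x) (locS s)) = 0)
    (h2 : ∀ z : P₀, (∀ s : SelRel, c₂ z (loc₂ s) = 0) →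
      ∃ a : A, a ≠ 0 ∧ ∃ x : H, ldS x = 0 ∧ a • z = ld₂ x)
    (h0 : ∀ χ : PS, (∀ s : SelRel, loc₂ s = 0 → cS χ (locS s) = 0) →
      ∃ a : A, a ≠ 0 ∧ ∃ x : H, a • χ = ldS x) :
    ∀ t : P₀ × PS, (∀ s : SelRel, c₂ t.1 (loc₂ s) + cS t.2 (locS s) = 0) →
      ∃ a : A, a ≠ 0 ∧ ∃ x : H, a • t = (ld₂.prod ldS) x := by
  rintro ⟨z, χ⟩ ht
  have hχ : ∀ s : SelRel, loc₂ s = 0 → cS χ (locS s) = 0 := by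
    intro s hs
    have h := ht s
    rw [hs, map_zero, zero_add] at h
    exact h
  obtain ⟨a₀, ha₀, x₀, hx₀⟩ := h0 χ hχ
  -- `(2 a₀) • z − ld₂ (2 • x₀)` kills `loc₂(SelRel)`
  have hz' : ∀ s : SelRel, c₂ ((2 * a₀) • z - ld₂ ((2 : A) • x₀)) (loc₂ s) = 0 := by
    intro s
    have h1 : c₂ z (loc₂ (a₀ • s)) + cS χ (locS (a₀ • s)) = 0 := ht (a₀ • s)
    rw [map_smul loc₂ a₀ s, map_smul locS a₀ s] at h1
    have h2 : 2 • (c₂ (ld₂ x₀) (loc₂ s) + cS (ldS x₀) (locS s)) = 0 := hEH₂ x₀ s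
    rw [← hx₀, map_smul cS a₀ χ, CharacterModule.smul_apply] at h2
    -- unfold the value: `c₂ ((2a₀) • z − ld₂ (2 • x₀)) (loc₂ s) = c₂ z ((2a₀) • loc₂ s) − c₂ (ld₂ x₀) (2 • loc₂ s)`
    have e0 : c₂ ((2 * a₀) • z - ld₂ ((2 : A) • x₀)) (loc₂ s) =
        (c₂ z) ((2 * a₀) • loc₂ s) - (c₂ (ld₂ x₀)) ((2 : A) • loc₂ s) := by
      rw [map_sub c₂, map_smul c₂, map_smul ld₂, map_smul c₂]
      rfl
    have e1 : (c₂ z) ((2 * a₀) • loc₂ s) = (c₂ z) (a₀ • loc₂ s) + (c₂ z) (a₀ • loc₂ s) := by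
      rw [mul_smul, two_smul, map_add]
    have e2 : (c₂ (ld₂ x₀)) ((2 : A) • loc₂ s) = (c₂ (ld₂ x₀)) (loc₂ s) + (c₂ (ld₂ x₀)) (loc₂ s) := by
      rw [two_smul, map_add]
    have e3 : c₂ z (a₀ • loc₂ s) = -cS χ (a₀ • locS s) := eq_neg_of_add_eq_zero_left h1
    rw [e0, e1, e2, e3]
    rw [two_nsmul] at h2
    have e4 : -(cS χ) (a₀ • locS s) + -(cS χ) (a₀ • locS s) - ((c₂ (ld₂ x₀)) (loc₂ s) + (c₂ (ld₂ x₀)) (loc₂ s)) =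
        -((c₂ (ld₂ x₀)) (loc₂ s) + (cS χ) (a₀ • locS s) + ((c₂ (ld₂ x₀)) (loc₂ s) + (cS χ) (a₀ • locS s))) := by
      abel
    rw [e4, h2, neg_zero]
  obtain ⟨a₁, ha₁, x₁, hx₁S, hx₁⟩ := h2 _ hz'
  refine ⟨a₁ * (2 * a₀), mul_ne_zero ha₁ (mul_ne_zero htwo ha₀), a₁ • ((2 : A) • x₀) + x₁, ?_⟩
  refine Prod.ext ?_ ?_
  · show (a₁ * (2 * a₀)) • z = ld₂ (a₁ • ((2 : A) • x₀) + x₁)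
    rw [mul_smul, map_add, map_smul, ← hx₁, smul_sub, add_sub_cancel]
  · show (a₁ * (2 * a₀)) • χ = ldS (a₁ • ((2 : A) • x₀) + x₁)
    rw [mul_smul, mul_smul, hx₀, map_add, map_smul, map_smul, hx₁S, add_zero]

/-- **The converse slice at `2` (U37′)**: `hDHrel` ⟹ S4₂ (`χ = 0`), no hypothesis. [cite: Kobayashi2003, Thm. 7.3 ((7.21), p. 13)] -/
theorem atTwo_of_hDHrel
    (c₂ : P₀ →ₗ[A] CharacterModule D₂) (cS : PS →ₗ[A] CharacterModule DS)
    (loc₂ : SelRel →ₗ[A] D₂) (locS : SelRel →ₗ[A] DS)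
    (ld₂ : H →ₗ[A] P₀) (ldS : H →ₗ[A] PS)
    (hDHrel : ∀ t : P₀ × PS, (∀ s : SelRel, c₂ t.1 (loc₂ s) + cS t.2 (locS s) = 0) →
      ∃ a : A, a ≠ 0 ∧ ∃ x : H, a • t = (ld₂.prod ldS) x) :
    ∀ z : P₀, (∀ s : SelRel, c₂ z (loc₂ s) = 0) →
      ∃ a : A, a ≠ 0 ∧ ∃ x : H, ldS x = 0 ∧ a • z = ld₂ x := by
  intro z hz
  obtain ⟨a, ha, x, hx⟩ := hDHrel (z, 0) fun s ↦ by
    show c₂ z (loc₂ s) + cS 0 (locS s) = 0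
    rw [hz s, map_zero, zero_add]
    rfl
  have h1 : a • z = ld₂ x := by simpa using congrArg Prod.fst hx
  have h2 : (a • (0 : PS)) = ldS x := by simpa using congrArg Prod.snd hx
  exact ⟨a, ha, x, by rw [← h2, smul_zero], h1⟩

/-- **(U38) SelRel-wide reciprocity ⟹ `pair (locd x) = 0` for every global family `x`** (so p673478's `(EH_Z)` for any `Z ≤ H`), under
p673742's `hcompat` / `hloc` with `loc' := ld₂.prod ldS`. [cite: MilneADT2006, Ch. I, Thm. 4.10 (b)] -/
theorem pair_locd_eq_zero_of_reciprocity
    (c₂ : P₀ →ₗ[A] CharacterModule D₂) (cS : PS →ₗ[A] CharacterModule DS)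
    (loc₂ : SelRel →ₗ[A] D₂) (locS : SelRel →ₗ[A] DS)
    (ld₂ : H →ₗ[A] P₀) (ldS : H →ₗ[A] PS)
    (Sg : Submodule A SelRel) (π : (P₀ × PS) →ₗ[A] P) (pair : P →ₗ[A] CharacterModule Sg)
    (hcompat : ∀ (t : P₀ × PS) (s : Sg), pair (π t) s = c₂ t.1 (loc₂ s) + cS t.2 (locS s))
    (locd : H →ₗ[A] P) (hloc : ∀ x, locd x = π ((ld₂.prod ldS) x))
    (hEH : ∀ (x : H) (s : SelRel), c₂ (ld₂ x) (loc₂ s) + cS (ldS x) (locS s) = 0) :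
    ∀ x : H, pair (locd x) = 0 := by
  intro x
  ext s
  rw [hloc, hcompat]
  exact hEH x s

/-- **(U38, `2 •` form)**: EH₂ ⟹ `2 • pair (locd x) = 0` for every `x` (the EH₂ binder of the `2 •`-adapters
`ReciprocityReceptacle.le_finrank_…_of_two_nsmul`). [cite: MilneADT2006, Ch. I, Thm. 4.10 (b)] -/
theorem two_nsmul_pair_locd_eq_zero_of_reciprocity_two_nsmul
    (c₂ : P₀ →ₗ[A] CharacterModule D₂) (cS : PS →ₗ[A] CharacterModule DS)
    (loc₂ : SelRel →ₗ[A] D₂) (locS : SelRel →ₗ[A] DS)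
    (ld₂ : H →ₗ[A] P₀) (ldS : H →ₗ[A] PS)
    (Sg : Submodule A SelRel) (π : (P₀ × PS) →ₗ[A] P) (pair : P →ₗ[A] CharacterModule Sg)
    (hcompat : ∀ (t : P₀ × PS) (s : Sg), pair (π t) s = c₂ t.1 (loc₂ s) + cS t.2 (locS s))
    (locd : H →ₗ[A] P) (hloc : ∀ x, locd x = π ((ld₂.prod ldS) x))
    (hEH₂ : ∀ (x : H) (s : SelRel), 2 • (c₂ (ld₂ x) (loc₂ s) + cS (ldS x) (locS s)) = 0) :
    ∀ x : H, 2 • pair (locd x) = 0 := by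
  intro x
  ext s
  rw [two_nsmul]
  change pair (locd x) s + pair (locd x) s = 0
  rw [hloc, hcompat, ← two_nsmul]
  exact hEH₂ x s

/-! ## §2 The relaxed deep half fed by the place cut -/

/-- **`deepHalfSigma_of_relaxed` FED BY THE PLACE CUT**: the N5 binder `hDH` for `(P, pair, locd)` from S4₂ (`h2`), S4₀ (`h0`), EH (`hEH`)
and p673742's remaining data (`c₂` onto, `Sg = loc₂⁻¹(E⁺)`, `π` onto with `ker π ⊇ ann(E⁺) × 0`, `pair ∘ π = pair'|Sg`, `locd = π ∘ (ld₂, ldS)`).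
[cite: Kobayashi2003, Thm. 7.3 ((7.17)–(7.21), pp. 12–13)] [cite: MilneADT2006, Ch. I, Thm. 4.10 (b)] [cite: Rubin2000, App. B §B.3] -/
theorem deepHalfSigma_of_placeCut [NoZeroDivisors A]
    (c₂ : P₀ →ₗ[A] CharacterModule D₂) (cS : PS →ₗ[A] CharacterModule DS) (hsurj : Function.Surjective c₂)
    (loc₂ : SelRel →ₗ[A] D₂) (locS : SelRel →ₗ[A] DS) (Eplus : Submodule A D₂)
    (Sg : Submodule A SelRel) (hSg : ∀ s, s ∈ Sg ↔ loc₂ s ∈ Eplus)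
    (π : (P₀ × PS) →ₗ[A] P) (hπ : Function.Surjective π)
    (hπker : ∀ h₂ : P₀, (∀ e ∈ Eplus, c₂ h₂ e = 0) → π (h₂, 0) = 0)
    (pair : P →ₗ[A] CharacterModule Sg)
    (hcompat : ∀ (t : P₀ × PS) (s : Sg), pair (π t) s = c₂ t.1 (loc₂ s) + cS t.2 (locS s))
    (ld₂ : H →ₗ[A] P₀) (ldS : H →ₗ[A] PS) (locd : H →ₗ[A] P) (hloc : ∀ x, locd x = π ((ld₂.prod ldS) x))
    (hEH : ∀ (x : H) (s : SelRel), c₂ (ld₂ x) (loc₂ s) + cS (ldS x) (locS s) = 0)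
    (h2 : ∀ z : P₀, (∀ s : SelRel, c₂ z (loc₂ s) = 0) →
      ∃ a : A, a ≠ 0 ∧ ∃ x : H, ldS x = 0 ∧ a • z = ld₂ x)
    (h0 : ∀ χ : PS, (∀ s : SelRel, loc₂ s = 0 → cS χ (locS s) = 0) →
      ∃ a : A, a ≠ 0 ∧ ∃ x : H, a • χ = ldS x) :
    ∀ z : P, pair z = 0 → ∃ a : A, a ≠ 0 ∧ ∃ x : H, a • z = locd x :=
  CharIdealLambda.deepHalfSigma_of_relaxed c₂ cS hsurj loc₂ locS Eplus Sg hSg π hπ hπker pair hcompat (ld₂.prod ldS) locd hloc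
    (hDHrel_of_placeCut c₂ cS loc₂ locS ld₂ ldS hEH h2 h0)

/-- **The same with EH₂** (`2 •`-form of reciprocity, `(2 : A) ≠ 0`). [cite: Kobayashi2003, Thm. 7.3 ((7.17)–(7.21), pp. 12–13)]
[cite: MilneADT2006, Ch. I, Thm. 4.10 (b)] -/
theorem deepHalfSigma_of_placeCut_of_two_nsmul [NoZeroDivisors A] (htwo : (2 : A) ≠ 0)
    (c₂ : P₀ →ₗ[A] CharacterModule D₂) (cS : PS →ₗ[A] CharacterModule DS) (hsurj : Function.Surjective c₂)
    (loc₂ : SelRel →ₗ[A] D₂) (locS : SelRel →ₗ[A] DS) (Eplus : Submodule A D₂)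
    (Sg : Submodule A SelRel) (hSg : ∀ s, s ∈ Sg ↔ loc₂ s ∈ Eplus)
    (π : (P₀ × PS) →ₗ[A] P) (hπ : Function.Surjective π)
    (hπker : ∀ h₂ : P₀, (∀ e ∈ Eplus, c₂ h₂ e = 0) → π (h₂, 0) = 0)
    (pair : P →ₗ[A] CharacterModule Sg)
    (hcompat : ∀ (t : P₀ × PS) (s : Sg), pair (π t) s = c₂ t.1 (loc₂ s) + cS t.2 (locS s))
    (ld₂ : H →ₗ[A] P₀) (ldS : H →ₗ[A] PS) (locd : H →ₗ[A] P) (hloc : ∀ x, locd x = π ((ld₂.prod ldS) x))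
    (hEH₂ : ∀ (x : H) (s : SelRel), 2 • (c₂ (ld₂ x) (loc₂ s) + cS (ldS x) (locS s)) = 0)
    (h2 : ∀ z : P₀, (∀ s : SelRel, c₂ z (loc₂ s) = 0) →
      ∃ a : A, a ≠ 0 ∧ ∃ x : H, ldS x = 0 ∧ a • z = ld₂ x)
    (h0 : ∀ χ : PS, (∀ s : SelRel, loc₂ s = 0 → cS χ (locS s) = 0) →
      ∃ a : A, a ≠ 0 ∧ ∃ x : H, a • χ = ldS x) :
    ∀ z : P, pair z = 0 → ∃ a : A, a ≠ 0 ∧ ∃ x : H, a • z = locd x :=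
  CharIdealLambda.deepHalfSigma_of_relaxed c₂ cS hsurj loc₂ locS Eplus Sg hSg π hπ hπker pair hcompat (ld₂.prod ldS) locd hloc
    (hDHrel_of_placeCut_of_two_nsmul htwo c₂ cS loc₂ locS ld₂ ldS hEH₂ h2 h0)

end ElementGlue

/-! ## §3 λ-currency glue for the corank road -/

section LambdaGlue

variable {A : Type u} [CommRing A] (K : Type w) [Field K] [Algebra A K] [IsFractionRing A K]
  {H : Type v} [AddCommGroup H] [Module A H] {L : Type v} [AddCommGroup L] [Module A L]
  (𝒸 : H →ₗ[A] L) (Hstr : Submodule A H)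

/-- **`λ(Λ/𝒸(H_str)) = λ(𝐇¹/H_str) + λ(Λ/𝒸(𝐇¹))`** for an injective `𝒸 : 𝐇¹ → Λ` and a submodule `H_str ≤ 𝐇¹`
(`0 → 𝐇¹/H_str → Λ/𝒸(H_str) → Λ/𝒸(𝐇¹) → 0` and flat base change, `LambdaLowerBoundO.finrank_baseChange_eq_of_exact_three`).
[cite: BurungaleTian2026, Thm. 2.6 (p. 5)] -/
theorem finrank_baseChange_quotient_map_eq_add (h𝒸 : Function.Injective 𝒸)
    [Module.Finite K (K ⊗[A] (L ⧸ Hstr.map 𝒸))] :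
    Module.finrank K (K ⊗[A] (L ⧸ Hstr.map 𝒸)) =
      Module.finrank K (K ⊗[A] (H ⧸ Hstr)) + Module.finrank K (K ⊗[A] (L ⧸ LinearMap.range 𝒸)) := by
  have hle : Hstr.map 𝒸 ≤ (LinearMap.range 𝒸).comap (LinearMap.id : L →ₗ[A] L) := by
    rw [Submodule.comap_id]; exact LinearMap.map_le_range
  refine LambdaLowerBoundO.finrank_baseChange_eq_of_exact_three K
    (Hstr.mapQ (Hstr.map 𝒸) 𝒸 (Submodule.le_comap_map 𝒸 Hstr))
    ((Hstr.map 𝒸).mapQ (LinearMap.range 𝒸) LinearMap.id hle) ?_ ?_ ?_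
  · rw [injective_iff_map_eq_zero]
    intro x hx
    induction x using Submodule.Quotient.induction_on with
    | H x =>
      rw [Submodule.mapQ_apply, Submodule.Quotient.mk_eq_zero, Submodule.mem_map] at hx
      obtain ⟨y, hy, hyx⟩ := hx
      rw [Submodule.Quotient.mk_eq_zero, ← h𝒸 hyx]
      exact hy
  · intro y
    induction y using Submodule.Quotient.induction_on with
    | H l =>
      constructor
      · intro hl
        rw [Submodule.mapQ_apply, LinearMap.id_apply, Submodule.Quotient.mk_eq_zero, LinearMap.mem_range] at hl
        obtain ⟨x, hx⟩ := hl
        exact ⟨Submodule.Quotient.mk x, by rw [Submodule.mapQ_apply, hx]⟩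
      · rintro ⟨x, hx⟩
        obtain ⟨x, rfl⟩ := Submodule.Quotient.mk_surjective Hstr x
        rw [Submodule.mapQ_apply, Submodule.Quotient.eq] at hx
        rw [Submodule.mapQ_apply, LinearMap.id_apply, Submodule.Quotient.mk_eq_zero]
        have : l = 𝒸 x - (𝒸 x - l) := by abel
        rw [this]
        exact sub_mem (LinearMap.mem_range_self 𝒸 x) (LinearMap.map_le_range hx)
  · intro c
    induction c using Submodule.Quotient.induction_on with
    | H l => exact ⟨Submodule.Quotient.mk l, rfl⟩

/-- **Corank-road glue of the place cut.** Along a flag `Fine ≤ Str₂ ≤ Sg` of the discrete Selmer module: block I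
`λ(Λ/𝒸(H_str)) ≤ λ((Sg/Str₂)⋆)` (at `2`) and block II `Σ ≤ λ((Str₂/Fine)⋆) + λ(𝐇¹/H_str)` (away from `2`) give
`Σ + λ(Λ/𝒸(𝐇¹)) ≤ λ(Sg⋆)` — the defect `λ(𝐇¹/H_str)` cancels (`CharIdealLambda.finrank_baseChange_characterModule_eq_add_quotient` twice).
[cite: BurungaleTian2026, Thm. 2.6 (p. 5)] [cite: Kobayashi2003, Thm. 7.3 ((7.21), p. 13)] -/
theorem add_finrank_le_of_placeCut {Sg : Type v} [AddCommGroup Sg] [Module A Sg]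
    (Str₂ : Submodule A Sg) (Fine : Submodule A Str₂) [Module.Finite K (K ⊗[A] CharacterModule Sg)]
    (h𝒸 : Function.Injective 𝒸) [Module.Finite K (K ⊗[A] (L ⧸ Hstr.map 𝒸))] {σ : ℕ}
    (hI : Module.finrank K (K ⊗[A] (L ⧸ Hstr.map 𝒸)) ≤ Module.finrank K (K ⊗[A] CharacterModule (Sg ⧸ Str₂)))
    (hII : σ ≤ Module.finrank K (K ⊗[A] CharacterModule (Str₂ ⧸ Fine)) +
      Module.finrank K (K ⊗[A] (H ⧸ Hstr))) :
    σ + Module.finrank K (K ⊗[A] (L ⧸ LinearMap.range 𝒸)) ≤ Module.finrank K (K ⊗[A] CharacterModule Sg) := by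
  have h1 := CharIdealLambda.finrank_baseChange_characterModule_eq_add_quotient K Str₂
  haveI := CharIdealLambda.finite_baseChange_characterModule_submodule K Str₂
  have h2 := CharIdealLambda.finrank_baseChange_characterModule_eq_add_quotient K Fine
  have h3 := finrank_baseChange_quotient_map_eq_add K 𝒸 Hstr h𝒸
  omega

end LambdaGlue

end Summit.BirchSwinnertonDyer.BirchSwinnertonDyer.Theorems.PlaceCutGlue

end
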